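import Summits.CriticalPhenomena.Ising3DConformalLimit.Theses.SubPtolemyInterlacing
import Literature.Probability.LatticeModels.HighDimPointwiseTriviality
import Literature.Probability.LatticeModels.ImprovedTreeDiagramBoundProofs
import Literature.Probability.LatticeModels.PointwiseScalingLimitEtaExists

/-!
# `SubPtolemyFloor` (item stmt-CriticalPhenomena-15703): the exponent window of the axial floor

Negative / structural knowledge about the crux
`Summit.CriticalPhenomena.Ising3DConformalLimit.Theses.SubPtolemyInterlacing.SubPtolemyFloor`
(route SubPtolemyInterlacing, r3: `∃ a c, a < log₂(1+√2) ∧ 0 < c ∧ ∀ n ≥ 1, c·n^{-a} ≤ ⟨σ₀σ_{n e₁}⟩⁺_{β_c(3)}`),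
from its standing crux disprover (D-0016); THEOREM-ONLY, no new definitions.

* `exponent_ge_dim_sub_two` — in every dimension `d ≥ 3`, a witness `(a, c)` of the axial floor has
  `d - 2 ≤ a` (infrared bound `⟨σ₀σ_v⟩_{β_c} ≤ C‖v‖_∞^{-(d-2)}`, tree theorem
  `exists_criticalTwoPoint_le_inv_pow` ← `criticalTwoPoint_bounds_holds`).
* `exponent_ge_one`, `subPtolemyFloor_iff_window` — on `ℤ³` every witness lives in the window
  `1 ≤ a < log₂(1+√2) ≈ 1.2716` (`one_lt_threshold`: the window is non-empty; truth `2Δ_σ = 1.036`).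
* `not_floor_of_threshold_le_one` — the natural strengthening "exponent below the infrared value"
  (threshold `T ≤ 1`) is FALSE; `floor_of_two_lt_threshold` — the weakening to any threshold `T > 2` is a
  THEOREM (Simon–Lieb `c‖x‖^{-2} ≤ ⟨σ₀σ_x⟩_{β_c}`); the crux sits at `T = log₂(1+√2)` inside the open strip
  `1 < T ≤ 2`.
* `floorAt_false_of_four_le` — the same statement on `ℤ^d`, `d ≥ 4`, is FALSE (`a ≥ d - 2 ≥ 2 > log₂(1+√2)`,
  `threshold_lt_two`): the restriction `d = 3` is load-bearing, no dimension-uniform argument proves r3.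
* `irNonSaturation_of_not_floor` — WHAT A REFUTATION COSTS: `¬ SubPtolemyFloor` implies non-saturation of
  the infrared bound along the axis, `∀ ε > 0, ∃ᶠ n, n·⟨σ₀σ_{n e₁}⟩_{β_c(3)} < ε` (verbatim the open item
  stmt-CriticalPhenomena-1342, "weak `η(3) > 0`", up to `Filter.frequently_atTop`); equivalently IR-saturation
  (`η(3) = 0` with `Z > 0`) would already prove the crux with `a = 1`.
-/

noncomputable section

namespace Summit.CriticalPhenomena.Ising3DConformalLimit.SubPtolemyFloorNegative

open Literature.Probability.LatticeModels Filter Set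
open Summit.CriticalPhenomena.Ising3DConformalLimit.Theses
open scoped Topology

/-! ### The threshold `log₂(1+√2)` as a number: `1 < log₂(1+√2) < 2` -/

/-- `1 < log₂(1+√2)` (i.e. `2 < 1 + √2`). [folklore] -/
theorem one_lt_threshold : (1 : ℝ) < Real.logb 2 (1 + Real.sqrt 2) := by
  rw [Real.lt_logb_iff_rpow_lt one_lt_two (by positivity), Real.rpow_one]
  have h : (1 : ℝ) < Real.sqrt 2 := by
    rw [Real.lt_sqrt zero_le_one]; norm_num
  linarith

/-- `log₂(1+√2) < 2` (i.e. `1 + √2 < 4`). [folklore] -/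
theorem threshold_lt_two : Real.logb 2 (1 + Real.sqrt 2) < 2 := by
  rw [Real.logb_lt_iff_lt_rpow one_lt_two (by positivity)]
  have h : Real.sqrt 2 < 3 := by
    rw [Real.sqrt_lt' (by norm_num)]; norm_num
  have h4 : (2 : ℝ) ^ (2 : ℝ) = 4 := by norm_num
  linarith

/-! ### The infrared bound pins the exponent from below: `d - 2 ≤ a` -/

/-- `n • e₁ ≠ 0` for `n ≥ 1`. [folklore] -/
theorem axis_ne_zero {d : ℕ} [NeZero d] {n : ℕ} (hn : 1 ≤ n) :
    ((n : ℤ) • (Pi.single 0 1 : Site d)) ≠ 0 := by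
  rw [zsmul_single_zero_one]
  intro h0
  have := congr_fun h0 (0 : Fin d)
  simp at this
  omega

/-- `‖n • e₁‖_∞ = n`. [folklore] -/
theorem supNorm_axis {d : ℕ} [NeZero d] (n : ℕ) :
    Site.supNorm ((n : ℤ) • (Pi.single 0 1 : Site d)) = n := by
  rw [zsmul_single_zero_one, Site.supNorm_single]
  simp

/-- **Any axial power floor has exponent `a ≥ d - 2`** (`d ≥ 3`): if `c·n^{-a} ≤ ⟨σ₀σ_{n e₁}⟩⁺_{β_c(d)}` for
all `n ≥ 1` with `c > 0`, then `d - 2 ≤ a`, by the infrared bound `⟨σ₀σ_v⟩_{β_c} ≤ C‖v‖_∞^{-(d-2)}`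
(Fröhlich–Simon–Spencer 1976 / Duminil-Copin 2019 Thm. 4.8, tree theorem
`exists_criticalTwoPoint_le_inv_pow`). [cite: DuminilCopin2019, Thm. 4.8, §4.4] -/
theorem exponent_ge_dim_sub_two {d : ℕ} [NeZero d] (hd : 3 ≤ d) {a c : ℝ} (hc : 0 < c)
    (h : ∀ n : ℕ, 1 ≤ n →
      c * (n : ℝ) ^ (-a) ≤ criticalTwoPoint d ((n : ℤ) • (Pi.single 0 1 : Site d))) :
    (d : ℝ) - 2 ≤ a := by
  by_contra hlt
  rw [not_le] at hlt
  obtain ⟨C, -, hC⟩ := exists_criticalTwoPoint_le_inv_pow hd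
  have hpowcast : ∀ n : ℕ, 1 ≤ n → ((n : ℝ) ^ (d - 2 : ℕ)) = (n : ℝ) ^ ((d : ℝ) - 2) := by
    intro n _
    rw [← Real.rpow_natCast]
    congr 1
    rw [Nat.cast_sub (by omega : 2 ≤ d)]
    norm_num
  have key : ∀ n : ℕ, 1 ≤ n → c * (n : ℝ) ^ ((d : ℝ) - 2 - a) ≤ C := by
    intro n hn
    have hn0 : (0 : ℝ) < n := by exact_mod_cast hn
    have h2 := hC _ (axis_ne_zero hn)
    rw [supNorm_axis] at h2
    have h3 : c * (n : ℝ) ^ (-a) ≤ C * ((n : ℝ) ^ (d - 2 : ℕ))⁻¹ := (h n hn).trans h2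
    have h4 : c * (n : ℝ) ^ (-a) * (n : ℝ) ^ ((d : ℝ) - 2) ≤
        C * ((n : ℝ) ^ (d - 2 : ℕ))⁻¹ * (n : ℝ) ^ ((d : ℝ) - 2) :=
      mul_le_mul_of_nonneg_right h3 (Real.rpow_nonneg hn0.le _)
    calc c * (n : ℝ) ^ ((d : ℝ) - 2 - a)
        = c * (n : ℝ) ^ (-a) * (n : ℝ) ^ ((d : ℝ) - 2) := by
          rw [show ((d : ℝ) - 2 - a) = -a + ((d : ℝ) - 2) by ring, Real.rpow_add hn0, mul_assoc]
      _ ≤ C * ((n : ℝ) ^ (d - 2 : ℕ))⁻¹ * (n : ℝ) ^ ((d : ℝ) - 2) := h4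
      _ = C := by
          rw [← hpowcast n hn, mul_assoc, inv_mul_cancel₀ (pow_ne_zero _ hn0.ne'), mul_one]
  have hpos : 0 < (d : ℝ) - 2 - a := by linarith
  have ht : Tendsto (fun n : ℕ => c * (n : ℝ) ^ ((d : ℝ) - 2 - a)) atTop atTop :=
    Tendsto.const_mul_atTop hc ((tendsto_rpow_atTop hpos).comp tendsto_natCast_atTop_atTop)
  obtain ⟨n, hnC, hn1⟩ := ((ht.eventually_gt_atTop C).and (eventually_ge_atTop 1)).exists
  exact absurd (key n hn1) (not_le.2 hnC)

/-- **On `ℤ³` every witness has `a ≥ 1`** (`η ≥ 0` in the one-sided sense; infrared bound). [cite: DuminilCopin2019, Thm. 4.8, §4.4] -/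
theorem exponent_ge_one {a c : ℝ} (hc : 0 < c)
    (h : ∀ n : ℕ, 1 ≤ n →
      c * (n : ℝ) ^ (-a) ≤ criticalTwoPoint 3 ((n : ℤ) • (Pi.single 0 1 : Site 3))) :
    1 ≤ a := by
  have := exponent_ge_dim_sub_two (d := 3) le_rfl hc h
  norm_num at this
  exact this

/-- **The crux is equivalent to its windowed form**: `SubPtolemyFloor ↔ ∃ a c, 1 ≤ a < log₂(1+√2) ∧ 0 < c ∧ …`
— the effective range of the exponent is `[1, 1.2716)` (truth: `2Δ_σ = 1.0363`). [folklore] -/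
theorem subPtolemyFloor_iff_window :
    SubPtolemyInterlacing.SubPtolemyFloor ↔
      ∃ a c : ℝ, 1 ≤ a ∧ a < Real.logb 2 (1 + Real.sqrt 2) ∧ 0 < c ∧ ∀ n : ℕ, 1 ≤ n →
        c * (n : ℝ) ^ (-a) ≤ criticalTwoPoint 3 ((n : ℤ) • (Pi.single 0 1 : Site 3)) := by
  constructor
  · rintro ⟨a, c, ha, hc, h⟩
    exact ⟨a, c, exponent_ge_one hc h, ha, hc, h⟩
  · rintro ⟨a, c, -, ha, hc, h⟩
    exact ⟨a, c, ha, hc, h⟩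

/-! ### The threshold landscape on `ℤ³`: false for `T ≤ 1`, theorem for `T > 2`, open in between -/

/-- **Strengthening refuted**: with any threshold `T ≤ 1` in place of `log₂(1+√2)` the axial floor is FALSE
(an exponent `a < 1` contradicts the infrared bound). [cite: DuminilCopin2019, Thm. 4.8, §4.4] -/
theorem not_floor_of_threshold_le_one {T : ℝ} (hT : T ≤ 1) :
    ¬ ∃ a c : ℝ, a < T ∧ 0 < c ∧ ∀ n : ℕ, 1 ≤ n →
        c * (n : ℝ) ^ (-a) ≤ criticalTwoPoint 3 ((n : ℤ) • (Pi.single 0 1 : Site 3)) := by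
  rintro ⟨a, c, ha, hc, h⟩
  have := exponent_ge_one hc h
  linarith

/-- **Weakening is a theorem**: with any threshold `T > 2` the axial floor HOLDS, by the Simon–Lieb lower
bound `c‖x‖_∞^{-2} ≤ ⟨σ₀σ_x⟩⁺_{β_c(3)}` (tree theorem `criticalTwoPoint_bounds_holds`; Simon 1980, Lieb 1980,
Duminil-Copin 2019 Thm. 4.8). So the crux is open exactly because its threshold `1.2716` lies in `(1, 2]`.
[cite: DuminilCopin2019, Thm. 4.8, §4.4] -/
theorem floor_of_two_lt_threshold {T : ℝ} (hT : 2 < T) :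
    ∃ a c : ℝ, a < T ∧ 0 < c ∧ ∀ n : ℕ, 1 ≤ n →
        c * (n : ℝ) ^ (-a) ≤ criticalTwoPoint 3 ((n : ℤ) • (Pi.single 0 1 : Site 3)) := by
  obtain ⟨c, C, hc, h⟩ := criticalTwoPoint_bounds_holds (d := 3) le_rfl
  refine ⟨2, c, hT, hc, fun n hn => ?_⟩
  have h1 := (h _ (axis_ne_zero hn)).1
  rw [Site.norm_eq_supNorm, supNorm_axis] at h1
  have e : (-(((3 : ℕ) : ℝ) - 1)) = -2 := by norm_num
  rw [e] at h1
  exact h1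

/-! ### The restriction `d = 3` is load-bearing: the statement fails on `ℤ^d`, `d ≥ 4` -/

/-- **The dimension-`d` form of the crux is FALSE for every `d ≥ 4`**: there the infrared bound forces
`a ≥ d - 2 ≥ 2 > log₂(1+√2)`. Hence no dimension-uniform argument can prove r3 (consistent with the route's
reading of `Literature.Barriers.CriticalPhenomena.IsingTrivialityFromDimensionFour`). [cite: DuminilCopin2019, Thm. 4.8, §4.4] -/
theorem floorAt_false_of_four_le {d : ℕ} [NeZero d] (hd : 4 ≤ d) :
    ¬ ∃ a c : ℝ, a < Real.logb 2 (1 + Real.sqrt 2) ∧ 0 < c ∧ ∀ n : ℕ, 1 ≤ n →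
        c * (n : ℝ) ^ (-a) ≤ criticalTwoPoint d ((n : ℤ) • (Pi.single 0 1 : Site d)) := by
  rintro ⟨a, c, ha, hc, h⟩
  have h1 := exponent_ge_dim_sub_two (by omega) hc h
  have h4 : (4 : ℝ) ≤ d := by exact_mod_cast hd
  linarith [threshold_lt_two]

/-- At `d = 3` the dimension-`d` form is r3 verbatim. [folklore] -/
theorem floorAt_three_iff :
    (∃ a c : ℝ, a < Real.logb 2 (1 + Real.sqrt 2) ∧ 0 < c ∧ ∀ n : ℕ, 1 ≤ n →
        c * (n : ℝ) ^ (-a) ≤ criticalTwoPoint 3 ((n : ℤ) • (Pi.single 0 1 : Site 3))) ↔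
      SubPtolemyInterlacing.SubPtolemyFloor :=
  Iff.rfl

/-! ### What a refutation costs: `¬ r3 ⇒` weak `η(3) > 0` (non-saturation of the infrared bound) -/

/-- **A refutation of r3 proves weak `η(3) > 0`**: `¬ SubPtolemyFloor` implies that the infrared bound is
NOT saturated along the axis — for every `ε > 0` and every `N` there is `n ≥ N` with
`n·⟨σ₀σ_{n e₁}⟩_{β_c(3)} < ε` (up to `Filter.frequently_atTop` this is verbatim the open item
stmt-CriticalPhenomena-1342, `PerfectScreening.NonSaturation`; rigorously open on `ℤ³`, Duminil-Copin
ICM 2022 §4.2). Contrapositive content: IR-saturation `n·⟨σ₀σ_{n e₁}⟩ ≥ ε` for `n ≥ N` gives the floor with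
`a = 1 < log₂(1+√2)` and `c = min ε ⟨σ₀σ_{M e₁}⟩`, `M = max N 1`, the small `n` being filled by axial
monotonicity (Messager–Miracle-Solé, `criticalTwoPoint_axis_antitone`) and positivity. [cite: DuminilCopinICM2022, §4.2.1 p. 12] -/
theorem irNonSaturation_of_not_floor (hnot : ¬ SubPtolemyInterlacing.SubPtolemyFloor)
    {ε : ℝ} (hε : 0 < ε) (N : ℕ) :
    ∃ n : ℕ, N ≤ n ∧ (n : ℝ) * criticalTwoPoint 3 (Pi.single 0 (n : ℤ)) < ε := by
  by_contra hcon
  have hN : ∀ n : ℕ, N ≤ n → ε ≤ (n : ℝ) * criticalTwoPoint 3 (Pi.single 0 (n : ℤ)) := by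
    intro n hn
    by_contra hlt
    exact hcon ⟨n, hn, lt_of_not_ge hlt⟩
  apply hnot
  set M : ℕ := max N 1 with hM
  refine ⟨1, min ε (criticalTwoPoint 3 (Pi.single 0 (M : ℤ))), one_lt_threshold,
    lt_min hε (criticalTwoPoint_axis_pos M), fun n hn => ?_⟩
  rw [zsmul_single_zero_one, Real.rpow_neg_one]
  have hn0 : (0 : ℝ) < n := by exact_mod_cast hn
  have hinv : (n : ℝ)⁻¹ ≤ 1 := inv_le_one_of_one_le₀ (by exact_mod_cast hn)
  rcases le_or_gt M n with hle | hlt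
  · have h1 : ε ≤ (n : ℝ) * criticalTwoPoint 3 (Pi.single 0 (n : ℤ)) := hN n ((le_max_left _ _).trans hle)
    calc min ε (criticalTwoPoint 3 (Pi.single 0 (M : ℤ))) * (n : ℝ)⁻¹
        ≤ ε * (n : ℝ)⁻¹ := mul_le_mul_of_nonneg_right (min_le_left _ _) (inv_nonneg.2 hn0.le)
      _ ≤ criticalTwoPoint 3 (Pi.single 0 (n : ℤ)) := by
          rw [← div_eq_mul_inv, div_le_iff₀ hn0, mul_comm]
          exact h1
  · have hmono : criticalTwoPoint 3 (Pi.single 0 (M : ℤ)) ≤ criticalTwoPoint 3 (Pi.single 0 (n : ℤ)) :=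
      criticalTwoPoint_axis_antitone hlt.le
    calc min ε (criticalTwoPoint 3 (Pi.single 0 (M : ℤ))) * (n : ℝ)⁻¹
        ≤ criticalTwoPoint 3 (Pi.single 0 (M : ℤ)) * 1 :=
          mul_le_mul (min_le_right _ _) hinv (inv_nonneg.2 hn0.le) (criticalTwoPoint_axis_pos M).le
      _ ≤ criticalTwoPoint 3 (Pi.single 0 (n : ℤ)) := by rw [mul_one]; exact hmono

end Summit.CriticalPhenomena.Ising3DConformalLimit.SubPtolemyFloorNegative

end
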